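import Literature.Analysis.FluidPDE.AxisymmetricTypeIPressureBounds
import Literature.Analysis.FluidPDE.SereginSverakBlowupSelection
import Literature.Analysis.FluidPDE.TsaiLocalEnergyProofs
import Literature.Analysis.FluidPDE.NSEssSupBound
import HarnessLib

/-!
# Boundedness near the final time outside a large ball: `typeI_boundedNearTop_infinity` from the
# one-scale ε-regularity criterion (Lemarié-Rieusset 2016, Thm. 14.4)

Analysis/FluidPDE proofs-layer file (theorems only), third layer of the decomposition of
`Literature.Analysis.FluidPDE.knss_no_axisymmetric_typeI` (`Axisymmetric.lean`) through
`axisymmetric_typeI_bounded` (`KNSSTypeII.lean`) and its local inputs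
(`AxisymmetricTypeIBounded.lean`). It PROVES the input at spatial infinity

  `typeI_boundedNearTop_infinity_of_LR :
     lemarieRieusset_epsilon_regularity → typeI_boundedNearTop_infinity`

from the accepted one-scale ε-regularity criterion in backward cylinders
(`lemarieRieusset_epsilon_regularity`, `CKNEpsilonRegularity.lean`; Caffarelli–Kohn–Nirenberg 1982
Prop. 1 / Cor. 1 in the form of Lemarié-Rieusset 2016, Thm. 14.4: if
`∫∫_{Q_{r₀}(z₀)} (|u|³ + |p|^{3/2}) ≤ λ³ r₀²`, `λ ≤ ε₀`, then `|u| ≤ C₀ λ / r₀` a.e. on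
`Q_{r₀/2}(z₀)`), as announced in `AxisymmetricTypeIBounded.lean` — the far-field step of the
argument of Escauriaza–Seregin–Šverák 2003, (3.6) (`NSEssSupBound.lean` for `L_{3,∞}` solutions).

## The argument

Let `H : AxisymmetricTypeIHyp ν T u p` (axisymmetry is not used), `q` its gauged pressure
(`exists_gauged_pressure`: `(u, q)` suitable on every open region below `T`, `q(t) = p̃[u(t)]` a.e.),
`r₀ = √T / 2`. On each cylinder `Q = Q_{r₀}(T, x₀)` the hypotheses of the criterion hold: the energy
class from the energy inequality; the weak spatial gradient `G₀` of the local energy inequality has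
`∫_Q |G₀|² < ∞` because it agrees a.e. (`HasWeakSpatialGradientOn.ae_eq`) with the square-integrable
weak gradient of the Leray–Hopf solution (`IsLerayHopfOn.exists_hasWeakSpatialGradientOn`);
`q ∈ L^{3/2}(Q)` (`lintegral_cylinder_gauged_pressure_lt_top`); no force. The smallness
`∫∫_Q (|u|³ + |q|^{3/2}) ≤ ε₀³ r₀²` holds for `|x₀|` large: `u ∈ L³` of the final slab, so its tails
are small (`exists_radius_tail_lt`); and by Hölder on the slices,
`∫∫_Q |q|^{3/2} ≤ |B_{r₀}|^{1/4} ∫ (∫_{|x| ≥ n} |p̃[u(t)]|²)^{3/4} dt → 0` as `n → ∞` by dominated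
convergence in `t` (dominant `‖p̃[u(t)]‖_{L²}^{3/2} ∈ L¹(0, T)`,
`lintegral_Ioo_eLpNorm_normalisedPressure_rpow_lt_top`) and in `x`. The criterion then bounds `u`
a.e. by `C₀ ε₀ / r₀` on `Q_{r₀/2}(T, x₀)` for all `|x₀|` large, hence everywhere there by continuity.

## References

* P. G. Lemarié-Rieusset, *The Navier–Stokes Problem in the 21st Century*, CRC Press 2016,
  Thm. 14.4 (p. 505). [LemarieRieusset2016]
* L. Caffarelli, R. Kohn, L. Nirenberg, Comm. Pure Appl. Math. 35 (1982), Prop. 1, Cor. 1.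
  [CaffarelliKohnNirenberg1982]
* L. Escauriaza, G. Seregin, V. Šverák, Russ. Math. Surveys 58 (2003), §3, (3.6).
  [EscauriazaSereginSverak2003]
-/

noncomputable section

open MeasureTheory Set Function Filter Topology TopologicalSpace Metric
open scoped NNReal ENNReal InnerProductSpace RealInnerProductSpace

namespace Literature.Analysis.FluidPDE

/-- Local notation for physical space `ℝ³ = EuclideanSpace ℝ (Fin 3)`. -/
local notation "ℝ³" => EuclideanSpace ℝ (Fin 3)

namespace AxisymmetricTypeIHyp

variable {ν T : ℝ} {u : ℝ → ℝ³ → ℝ³} {p : ℝ → ℝ³ → ℝ}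

/-! ### The far field of `u ∈ L³` -/

/-- `u ∈ L³` of every final strip `(a, T) × ℝ³`, `0 ≤ a` (Tonelli's inequality and
`lintegral_Ioo_lintegral_enorm_pow_three_lt_top`). [folklore] -/
theorem lintegral_strip_enorm_pow_three_lt_top (H : AxisymmetricTypeIHyp ν T u p) {a : ℝ}
    (ha : 0 ≤ a) :
    ∫⁻ z in Ioo a T ×ˢ (univ : Set ℝ³), ‖u z.1 z.2‖ₑ ^ (3 : ℕ) < ∞ := by
  calc ∫⁻ z in Ioo a T ×ˢ (univ : Set ℝ³), ‖u z.1 z.2‖ₑ ^ (3 : ℕ)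
      = ∫⁻ z, ‖u z.1 z.2‖ₑ ^ (3 : ℕ) ∂((volume.restrict (Ioo a T)).prod (volume : Measure ℝ³)) := by
        rw [Measure.restrict_prod_eq_prod_univ, ← Measure.volume_eq_prod]
    _ ≤ ∫⁻ t in Ioo a T, ∫⁻ x, ‖u t x‖ₑ ^ (3 : ℕ) := lintegral_prod_le _
    _ ≤ ∫⁻ t in Ioo 0 T, ∫⁻ x, ‖u t x‖ₑ ^ (3 : ℕ) := lintegral_mono_set (Ioo_subset_Ioo_left ha)
    _ < ∞ := H.lintegral_Ioo_lintegral_enorm_pow_three_lt_top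

/-- **Small `L³` mass on far cylinders**: for `r² ≤ T` and `η > 0` there is `n` with
`∫∫_{Q_r(T, x₀)} |u|³ < η` whenever `|x₀| ≥ n + r` (tails of the finite integral over the final
strip, `exists_radius_tail_lt`). [folklore] -/
theorem exists_radius_cylinder_enorm_pow_three_lt (H : AxisymmetricTypeIHyp ν T u p) {r : ℝ}
    (hrT : r ^ 2 ≤ T) {η : ℝ≥0∞} (hη : 0 < η) :
    ∃ n : ℕ, ∀ x₀ : ℝ³, (n : ℝ) + r ≤ ‖x₀‖ →
      ∫⁻ z in parabolicCylinder r ((T : ℝ), x₀), ‖u z.1 z.2‖ₑ ^ (3 : ℕ) < η := by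
  have hfin := H.lintegral_strip_enorm_pow_three_lt_top (a := T - r ^ 2) (by linarith)
  obtain ⟨n, hn⟩ := exists_radius_tail_lt hfin hη
  refine ⟨n, fun x₀ hx₀ => lt_of_le_of_lt (lintegral_mono_set ?_) hn⟩
  intro z hz
  rw [mem_parabolicCylinder] at hz
  refine ⟨⟨hz.1, mem_univ _⟩, ?_⟩
  show (n : ℝ) ≤ ‖z.2‖
  have h1 : ‖x₀‖ ≤ ‖z.2‖ + dist z.2 x₀ := by
    have := norm_le_norm_add_norm_sub' x₀ z.2
    rwa [← dist_eq_norm, dist_comm] at this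
  linarith [hz.2]

/-! ### The far field of the normalised pressure -/

/-- The tail functional `gₙ(t) = (∫_{|x| ≥ n} |p̃[u(t)]|²)^{3/4}` is dominated by
`‖p̃[u(t)]‖_{L²}^{3/2}`. [folklore] -/
theorem tail_normalisedPressure_rpow_le (t : ℝ) (n : ℕ) :
    (∫⁻ x in {x : ℝ³ | (n : ℝ) ≤ ‖x‖}, ‖normalisedPressure (u t) x‖ₑ ^ 2) ^ (3 / 4 : ℝ) ≤
      eLpNorm (normalisedPressure (u t)) 2 volume ^ (3 / 2 : ℝ) := by
  calc (∫⁻ x in {x : ℝ³ | (n : ℝ) ≤ ‖x‖}, ‖normalisedPressure (u t) x‖ₑ ^ 2) ^ (3 / 4 : ℝ)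
      ≤ (∫⁻ x, ‖normalisedPressure (u t) x‖ₑ ^ 2) ^ (3 / 4 : ℝ) :=
        ENNReal.rpow_le_rpow (setLIntegral_le_lintegral _ _) (by norm_num)
    _ = eLpNorm (normalisedPressure (u t)) 2 volume ^ (3 / 2 : ℝ) := by
        rw [← eLpNorm_two_sq_eq_lintegral, ← ENNReal.rpow_natCast, ← ENNReal.rpow_mul]
        norm_num

/-- For `0 ≤ t < T` the tails `∫_{|x| ≥ n} |p̃[u(t)]|²` tend to `0` (dominated convergence in `x`,
`p̃[u(t)] ∈ L²`). [folklore] -/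
theorem tendsto_tail_normalisedPressure (H : AxisymmetricTypeIHyp ν T u p) {C : ℝ}
    (hC : ∀ t ∈ Ico 0 T, ∀ x, Real.sqrt (T - t) * ‖u t x‖ ≤ C) {t : ℝ} (ht : t ∈ Ico 0 T) :
    Tendsto (fun n : ℕ => ∫⁻ x in {x : ℝ³ | (n : ℝ) ≤ ‖x‖}, ‖normalisedPressure (u t) x‖ₑ ^ 2)
      atTop (𝓝 0) := by
  set g : ℝ³ → ℝ≥0∞ := fun x => ‖normalisedPressure (u t) x‖ₑ ^ 2 with hg
  have hgm : AEMeasurable g volume :=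
    ((aestronglyMeasurable_normalisedPressure_of_integrable (H.classical.contDiff_velocity ht)
      (H.integrable_norm_sq ht)).aemeasurable.enorm.pow_const 2)
  have hfin : ∫⁻ x, g x ≠ ∞ := by
    rw [hg, ← eLpNorm_two_sq_eq_lintegral]
    refine ENNReal.pow_ne_top (lt_of_le_of_lt (H.eLpNorm_normalisedPressure_le hC ht) ?_).ne
    exact ENNReal.mul_lt_top ENNReal.ofReal_lt_top (ENNReal.mul_lt_top ENNReal.ofReal_lt_top
      (ENNReal.rpow_lt_top_of_nonneg (by norm_num) ENNReal.ofReal_ne_top))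
  have hmeasA : ∀ n : ℕ, MeasurableSet {x : ℝ³ | (n : ℝ) ≤ ‖x‖} := fun n =>
    (isClosed_le continuous_const continuous_norm).measurableSet
  have h := tendsto_lintegral_of_dominated_convergence' (μ := (volume : Measure ℝ³))
    (F := fun n x => {x : ℝ³ | (n : ℝ) ≤ ‖x‖}.indicator g x) (f := fun _ => 0) g
    (fun n => hgm.indicator (hmeasA n)) (fun n => Eventually.of_forall fun x =>
      indicator_le_self _ _ x) hfin
    (Eventually.of_forall fun x => by
      refine tendsto_const_nhds.congr' ?_
      obtain ⟨n₀, hn₀⟩ := exists_nat_gt ‖x‖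
      filter_upwards [eventually_ge_atTop n₀] with n hn
      rw [indicator_of_notMem]
      simp only [mem_setOf_eq, not_le]
      exact hn₀.trans_le (Nat.cast_le.2 hn))
  simp only [lintegral_zero] at h
  refine h.congr fun n => ?_
  exact lintegral_indicator (hmeasA n) g

/-- **The far field of the normalised pressure**: `∫₀ᵀ (∫_{|x| ≥ n} |p̃[u(t)]|²)^{3/4} dt → 0`
(dominated convergence in `t`, dominant `‖p̃[u(t)]‖_{L²}^{3/2}`). [folklore] -/
theorem tendsto_lintegral_tail_normalisedPressure_rpow (H : AxisymmetricTypeIHyp ν T u p) :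
    Tendsto (fun n : ℕ => ∫⁻ t in Ioo 0 T,
      (∫⁻ x in {x : ℝ³ | (n : ℝ) ≤ ‖x‖}, ‖normalisedPressure (u t) x‖ₑ ^ 2) ^ (3 / 4 : ℝ))
      atTop (𝓝 0) := by
  obtain ⟨C, -, hC⟩ := H.exists_typeI_rate
  obtain ⟨q, -, hqae, hqm⟩ := H.exists_gauged_pressure
  have hmeasA : ∀ n : ℕ, MeasurableSet {x : ℝ³ | (n : ℝ) ≤ ‖x‖} := fun n =>
    (isClosed_le continuous_const continuous_norm).measurableSet
  -- measurability in `t` through the jointly measurable gauged pressure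
  have hmeas : ∀ n : ℕ, AEMeasurable (fun t => (∫⁻ x in {x : ℝ³ | (n : ℝ) ≤ ‖x‖},
      ‖normalisedPressure (u t) x‖ₑ ^ 2) ^ (3 / 4 : ℝ)) (volume.restrict (Ioo 0 T)) := by
    intro n
    set F : ℝ × ℝ³ → ℝ≥0∞ := fun z => {z : ℝ × ℝ³ | (n : ℝ) ≤ ‖z.2‖}.indicator
      (fun z => ‖uncurry q z‖ₑ ^ 2) z with hF
    have hprod : ((volume : Measure ℝ).restrict (Ioo 0 T)).prod (volume : Measure ℝ³) =
        (volume : Measure (ℝ × ℝ³)).restrict (Ioo 0 T ×ˢ univ) := by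
      rw [Measure.restrict_prod_eq_prod_univ, ← Measure.volume_eq_prod]
    have hFm : AEMeasurable F (((volume : Measure ℝ).restrict (Ioo 0 T)).prod volume) := by
      rw [hprod]
      exact (hqm.aemeasurable.enorm.pow_const 2).indicator
        ((isClosed_le continuous_const (continuous_norm.comp continuous_snd)).measurableSet)
    have h1 : AEMeasurable (fun t => ∫⁻ x, F (t, x)) (volume.restrict (Ioo 0 T)) :=
      hFm.lintegral_prod_right'
    have h2 : ∀ᵐ t ∂(volume.restrict (Ioo 0 T)), (∫⁻ x, F (t, x)) =
        ∫⁻ x in {x : ℝ³ | (n : ℝ) ≤ ‖x‖}, ‖normalisedPressure (u t) x‖ₑ ^ 2 := by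
      filter_upwards [hqae] with t ht
      have e : (fun x => F (t, x)) = {x : ℝ³ | (n : ℝ) ≤ ‖x‖}.indicator
          (fun x => ‖normalisedPressure (u t) x‖ₑ ^ 2) := by
        funext x
        by_cases hx : (n : ℝ) ≤ ‖x‖
        · simp only [hF]
          rw [indicator_of_mem (show ((t, x) : ℝ × ℝ³) ∈ {z : ℝ × ℝ³ | (n : ℝ) ≤ ‖z.2‖} from hx),
            indicator_of_mem (show x ∈ {x : ℝ³ | (n : ℝ) ≤ ‖x‖} from hx)]
          show ‖q t x‖ₑ ^ 2 = _
          rw [ht]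
        · simp only [hF]
          rw [indicator_of_notMem (show ((t, x) : ℝ × ℝ³) ∉ {z : ℝ × ℝ³ | (n : ℝ) ≤ ‖z.2‖} from hx),
            indicator_of_notMem (show x ∉ {x : ℝ³ | (n : ℝ) ≤ ‖x‖} from hx)]
      rw [e, lintegral_indicator (hmeasA n)]
    exact (h1.congr h2).pow_const _
  have h := tendsto_lintegral_of_dominated_convergence' (μ := volume.restrict (Ioo 0 T))
    (F := fun n t => (∫⁻ x in {x : ℝ³ | (n : ℝ) ≤ ‖x‖}, ‖normalisedPressure (u t) x‖ₑ ^ 2) ^ (3 / 4 : ℝ))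
    (f := fun _ => 0) (fun t => eLpNorm (normalisedPressure (u t)) 2 volume ^ (3 / 2 : ℝ))
    hmeas (fun n => Eventually.of_forall fun t => tail_normalisedPressure_rpow_le t n)
    H.lintegral_Ioo_eLpNorm_normalisedPressure_rpow_lt_top.ne
    ((ae_restrict_mem measurableSet_Ioo).mono fun t ht => by
      have h0 := H.tendsto_tail_normalisedPressure hC ⟨ht.1.le, ht.2⟩
      have h1 := ((ENNReal.continuous_rpow_const (y := (3 / 4 : ℝ))).tendsto 0).comp h0
      rw [ENNReal.zero_rpow_of_pos (by norm_num : (0 : ℝ) < 3 / 4)] at h1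
      exact h1)
  simpa using h

/-- **The `L^{3/2}` mass of a gauged pressure on a far cylinder is controlled by the tail
functional**: for `r² ≤ T` and `|x₀| ≥ n + r`,
`∫∫_{Q_r(T, x₀)} |q|^{3/2} ≤ |B_r|^{1/4} ∫₀ᵀ (∫_{|x| ≥ n} |p̃[u(t)]|²)^{3/4} dt`. [folklore] -/
theorem lintegral_cylinder_gauged_pressure_le_tail (H : AxisymmetricTypeIHyp ν T u p)
    {q : ℝ → ℝ³ → ℝ} (hq : ∀ᵐ t ∂(volume.restrict (Ioo 0 T)), q t = normalisedPressure (u t))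
    {r : ℝ} (hrT : r ^ 2 ≤ T) (n : ℕ) {x₀ : ℝ³} (hx₀ : (n : ℝ) + r ≤ ‖x₀‖) :
    ∫⁻ z in parabolicCylinder r ((T : ℝ), x₀), ‖q z.1 z.2‖ₑ ^ (3 / 2 : ℝ) ≤
      volume (ball (0 : ℝ³) r) ^ (1 / 4 : ℝ) * ∫⁻ t in Ioo 0 T,
        (∫⁻ x in {x : ℝ³ | (n : ℝ) ≤ ‖x‖}, ‖normalisedPressure (u t) x‖ₑ ^ 2) ^ (3 / 4 : ℝ) := by
  have hI : Ioo (T - r ^ 2) T ⊆ Ioo 0 T := Ioo_subset_Ioo_left (by linarith)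
  have hball : ball x₀ r ⊆ {x : ℝ³ | (n : ℝ) ≤ ‖x‖} := by
    intro x hx
    rw [mem_ball, dist_eq_norm] at hx
    show (n : ℝ) ≤ ‖x‖
    have h1 := norm_sub_norm_le x₀ x
    rw [norm_sub_rev] at h1
    linarith
  have hvol : volume (ball x₀ r) = volume (ball (0 : ℝ³) r) :=
    Measure.addHaar_ball_center volume x₀ r
  -- slice bound for a.e. `t ∈ (0, T)`
  have hslice : ∀ᵐ t ∂(volume.restrict (Ioo 0 T)), ∫⁻ x in ball x₀ r, ‖q t x‖ₑ ^ (3 / 2 : ℝ) ≤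
      (∫⁻ x in {x : ℝ³ | (n : ℝ) ≤ ‖x‖}, ‖normalisedPressure (u t) x‖ₑ ^ 2) ^ (3 / 4 : ℝ) *
        volume (ball (0 : ℝ³) r) ^ (1 / 4 : ℝ) := by
    filter_upwards [hq, ae_restrict_mem measurableSet_Ioo] with t ht htI
    rw [ht]
    have hm : AEStronglyMeasurable (normalisedPressure (u t)) volume :=
      aestronglyMeasurable_normalisedPressure_of_integrable
        (H.classical.contDiff_velocity ⟨htI.1.le, htI.2⟩) (H.integrable_norm_sq ⟨htI.1.le, htI.2⟩)
    refine (setLIntegral_rpow_threeHalves_le_of_sq volume (ball x₀ r) hm.aemeasurable.restrict).trans ?_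
    rw [hvol]
    exact mul_le_mul_left (ENNReal.rpow_le_rpow (lintegral_mono_set hball) (by norm_num)) _
  calc ∫⁻ z in parabolicCylinder r ((T : ℝ), x₀), ‖q z.1 z.2‖ₑ ^ (3 / 2 : ℝ)
      = ∫⁻ z, ‖q z.1 z.2‖ₑ ^ (3 / 2 : ℝ)
          ∂((volume.restrict (Ioo (T - r ^ 2) T)).prod (volume.restrict (ball x₀ r))) := by
        rw [Measure.prod_restrict, ← Measure.volume_eq_prod]; rfl
    _ ≤ ∫⁻ t in Ioo (T - r ^ 2) T, ∫⁻ x in ball x₀ r, ‖q t x‖ₑ ^ (3 / 2 : ℝ) := lintegral_prod_le _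
    _ ≤ ∫⁻ t in Ioo (T - r ^ 2) T,
          (∫⁻ x in {x : ℝ³ | (n : ℝ) ≤ ‖x‖}, ‖normalisedPressure (u t) x‖ₑ ^ 2) ^ (3 / 4 : ℝ) *
            volume (ball (0 : ℝ³) r) ^ (1 / 4 : ℝ) :=
        lintegral_mono_ae (ae_restrict_of_ae_restrict_of_subset hI hslice)
    _ ≤ ∫⁻ t in Ioo 0 T,
          (∫⁻ x in {x : ℝ³ | (n : ℝ) ≤ ‖x‖}, ‖normalisedPressure (u t) x‖ₑ ^ 2) ^ (3 / 4 : ℝ) *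
            volume (ball (0 : ℝ³) r) ^ (1 / 4 : ℝ) := lintegral_mono_set hI
    _ = volume (ball (0 : ℝ³) r) ^ (1 / 4 : ℝ) * ∫⁻ t in Ioo 0 T,
          (∫⁻ x in {x : ℝ³ | (n : ℝ) ≤ ‖x‖}, ‖normalisedPressure (u t) x‖ₑ ^ 2) ^ (3 / 4 : ℝ) := by
        rw [lintegral_mul_const' _ _ (ENNReal.rpow_ne_top_of_nonneg (by norm_num)
          measure_ball_lt_top.ne), mul_comm]

end AxisymmetricTypeIHyp

/-! ### The input at infinity from the one-scale criterion -/

/-- **Boundedness near the final time outside a large ball** — PROOF of the named target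
`typeI_boundedNearTop_infinity` (`AxisymmetricTypeIBounded.lean`) from the accepted one-scale
ε-regularity criterion `lemarieRieusset_epsilon_regularity` (Lemarié-Rieusset 2016, Thm. 14.4),
along the argument of the module docstring. [cite: LemarieRieusset2016, Thm. 14.4 p. 505] -/
theorem typeI_boundedNearTop_infinity_of_LR (hLR : lemarieRieusset_epsilon_regularity) :
    typeI_boundedNearTop_infinity := by
  intro ν T u p H
  have hν := H.viscosity_pos
  have hT := H.time_pos
  obtain ⟨ε₀, C₀, hε₀, hC₀, hcrit⟩ := hLR ν 3 hν (by norm_num)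
  -- the scale
  set r₀ : ℝ := Real.sqrt T / 2 with hr₀
  have hr₀pos : 0 < r₀ := by positivity
  have hr₀T : r₀ ^ 2 ≤ T := by
    rw [hr₀, div_pow, Real.sq_sqrt hT.le]; linarith
  have hr₀T' : (r₀ / 2) ^ 2 ≤ T := by nlinarith
  -- the smallness budget
  set η : ℝ≥0∞ := ENNReal.ofReal (ε₀ ^ 3 * r₀ ^ 2) / 2 with hη
  have hηpos : 0 < η := ENNReal.half_pos (ENNReal.ofReal_pos.2 (by positivity)).ne'
  -- the gauged pressure
  obtain ⟨q, hsuit, hqae, -⟩ := H.exists_gauged_pressure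
  -- far field of `u`
  obtain ⟨n₁, hn₁⟩ := H.exists_radius_cylinder_enorm_pow_three_lt hr₀T hηpos
  -- far field of `q`
  have hvol : volume (ball (0 : ℝ³) r₀) ^ (1 / 4 : ℝ) ≠ ∞ :=
    ENNReal.rpow_ne_top_of_nonneg (by norm_num) measure_ball_lt_top.ne
  have htail := ENNReal.Tendsto.const_mul H.tendsto_lintegral_tail_normalisedPressure_rpow (Or.inr hvol)
    (a := volume (ball (0 : ℝ³) r₀) ^ (1 / 4 : ℝ))
  rw [mul_zero] at htail
  obtain ⟨n₂, hn₂⟩ := ((tendsto_order.1 htail).2 η hηpos).exists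
  -- the square-integrable weak gradient of the Leray–Hopf solution on the slab
  obtain ⟨G', hG'slab, -, hG'int, -⟩ := H.lerayHopf.exists_hasWeakSpatialGradientOn
  -- conclusion
  refine ⟨max (n₁ : ℝ) n₂ + r₀, r₀ / 2, C₀ * ε₀ / r₀, by positivity, fun t ht x hx => ?_⟩
  -- the cylinder about `(T, x)`
  set Q : Opens (ℝ × ℝ³) := parabolicCylinderOpens r₀ ((T : ℝ), x) with hQdef
  have hQ : (Q : Set (ℝ × ℝ³)) = parabolicCylinder r₀ ((T : ℝ), x) := rfl
  have hQslab : (Q : Set (ℝ × ℝ³)) ⊆ Ioo 0 T ×ˢ (univ : Set ℝ³) := by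
    intro z hz
    rw [hQ, mem_parabolicCylinder] at hz
    exact ⟨⟨by nlinarith [hz.1.1], hz.1.2⟩, mem_univ _⟩
  have hQle : Q ≤ slab ℝ³ (Ioo 0 T) isOpen_Ioo := fun z hz => by
    rw [mem_slab]; exact (hQslab hz).1
  have hsws := hsuit Q hQslab
  obtain ⟨G₀, hG₀, -, hloc⟩ := hsws.localEnergy
  -- `∫_Q |G₀|² < ∞` through the Leray–Hopf gradient
  have hG₀int : ∫⁻ w in (Q : Set (ℝ × ℝ³)), ENNReal.ofReal (frobeniusNormSq (G₀ w.1 w.2)) < ∞ := by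
    have hae : ∀ᵐ w ∂(volume.restrict (Q : Set (ℝ × ℝ³))),
        ENNReal.ofReal (frobeniusNormSq (G₀ w.1 w.2)) = ENNReal.ofReal (frobeniusNormSq (G' w.1 w.2)) := by
      filter_upwards [hG₀.ae_eq (hG'slab.mono hQle)] with w hw
      change ENNReal.ofReal (frobeniusNormSq (uncurry G₀ w)) =
        ENNReal.ofReal (frobeniusNormSq (uncurry G' w))
      rw [hw]
    rw [lintegral_congr_ae hae]
    refine lt_of_le_of_lt (lintegral_mono_set ?_) hG'int
    rw [hQ]
    exact hQslab
  -- the energy class in indicator form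
  set CE : ℝ≥0 := Real.toNNReal (2 * VectorCalculus.kineticEnergy (u 0)) with hCE
  have hCEind : ∀ᵐ s : ℝ, ∫⁻ y, (Q : Set (ℝ × ℝ³)).indicator
      (fun w : ℝ × ℝ³ => ‖u w.1 w.2‖ₑ ^ 2) (s, y) ≤ CE := by
    rw [hQ, parabolicCylinder]
    refine ae_lintegral_indicator_prod_le measurableSet_ball (ae_of_all _ fun s hs => ?_)
    have hsI : s ∈ Ico 0 T := ⟨by nlinarith [hs.1], hs.2⟩
    calc ∫⁻ y in ball x r₀, ‖u s y‖ₑ ^ 2 ≤ eEnergy (u s) := setLIntegral_le_lintegral _ _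
      _ ≤ ENNReal.ofReal (2 * VectorCalculus.kineticEnergy (u 0)) := H.eEnergy_le hsI
      _ = CE := rfl
  have hp' : ∫⁻ w in (Q : Set (ℝ × ℝ³)), ‖q w.1 w.2‖ₑ ^ (3 / 2 : ℝ) < ∞ := by
    rw [hQ]; exact H.lintegral_cylinder_gauged_pressure_lt_top hqae hr₀T x
  -- the zero force
  have hfq : MemLp (uncurry (0 : ℝ → ℝ³ → ℝ³)) (ENNReal.ofReal 3)
      (volume.restrict (Q : Set (ℝ × ℝ³))) :=
    (MemLp.zero : MemLp (0 : ℝ × ℝ³ → ℝ³) (ENNReal.ofReal 3) (volume.restrict (Q : Set (ℝ × ℝ³))))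
  have hforce : ∫⁻ w in parabolicCylinder r₀ ((T : ℝ), x), ‖(0 : ℝ → ℝ³ → ℝ³) w.1 w.2‖ₑ ^ (3 : ℝ) ≤
      ENNReal.ofReal (ε₀ ^ ((2 : ℝ) * 3) * r₀ ^ ((5 : ℝ) - 3 * 3)) := by
    simp [ENNReal.zero_rpow_of_pos (by norm_num : (0 : ℝ) < 3)]
  -- smallness on the far cylinder `Q_{r₀}(T, x)`, `|x| ≥ max n₁ n₂ + r₀`
  have hx₁ : (n₁ : ℝ) + r₀ ≤ ‖x‖ := by linarith [le_max_left (n₁ : ℝ) n₂]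
  have hx₂ : (n₂ : ℝ) + r₀ ≤ ‖x‖ := by linarith [le_max_right (n₁ : ℝ) n₂]
  have hmeas_u : AEMeasurable (fun w : ℝ × ℝ³ => ‖u w.1 w.2‖ₑ ^ (3 : ℕ))
      (volume.restrict (parabolicCylinder r₀ ((T : ℝ), x))) := by
    have h1 : AEStronglyMeasurable (uncurry u) (volume.restrict (parabolicCylinder r₀ ((T : ℝ), x))) :=
      hsws.distributional.1.aestronglyMeasurable
    exact (h1.aemeasurable.enorm.pow_const 3)
  have hint : ∫⁻ w in parabolicCylinder r₀ ((T : ℝ), x),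
      (‖u w.1 w.2‖ₑ ^ (3 : ℕ) + ‖q w.1 w.2‖ₑ ^ (3 / 2 : ℝ)) ≤ ENNReal.ofReal (ε₀ ^ 3 * r₀ ^ 2) := by
    rw [lintegral_add_left' hmeas_u]
    have hu3 : ∫⁻ w in parabolicCylinder r₀ ((T : ℝ), x), ‖u w.1 w.2‖ₑ ^ (3 : ℕ) ≤ η :=
      (hn₁ x hx₁).le
    have hq32 : ∫⁻ w in parabolicCylinder r₀ ((T : ℝ), x), ‖q w.1 w.2‖ₑ ^ (3 / 2 : ℝ) ≤ η :=
      (H.lintegral_cylinder_gauged_pressure_le_tail hqae hr₀T n₂ hx₂).trans (hn₂).le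
    calc (∫⁻ w in parabolicCylinder r₀ ((T : ℝ), x), ‖u w.1 w.2‖ₑ ^ (3 : ℕ)) +
          ∫⁻ w in parabolicCylinder r₀ ((T : ℝ), x), ‖q w.1 w.2‖ₑ ^ (3 / 2 : ℝ)
        ≤ η + η := add_le_add hu3 hq32
      _ = ENNReal.ofReal (ε₀ ^ 3 * r₀ ^ 2) := ENNReal.add_halves _
  -- the criterion
  have hbdd := hcrit Q 0 u q G₀ (by rw [hQ]; exact isConnected_parabolicCylinder hr₀pos _)
    ⟨CE, hCEind⟩ hG₀ hG₀int hp' hfq hsws.distributional hloc ((T : ℝ), x) r₀ ε₀ hr₀pos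
    (by rw [hQ]) hε₀.le le_rfl hint hforce
  -- everywhere on `Q_{r₀/2}(T, x)` by continuity
  have hUopen : IsOpen (parabolicCylinder (r₀ / 2) ((T : ℝ), x)) := isOpen_parabolicCylinder _ _
  have hUslab : parabolicCylinder (r₀ / 2) ((T : ℝ), x) ⊆ Ioo 0 T ×ˢ (univ : Set ℝ³) := by
    intro z hz
    rw [mem_parabolicCylinder] at hz
    exact ⟨⟨by nlinarith [hz.1.1], hz.1.2⟩, mem_univ _⟩
  have hcont : ContinuousOn (fun z : ℝ × ℝ³ => u z.1 z.2) (parabolicCylinder (r₀ / 2) ((T : ℝ), x)) :=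
    H.classical_Ioo.smooth_velocity.continuousOn.mono hUslab
  have hall := SereginSverak2009.forall_le_of_ae_le_of_continuousOn hUopen hcont.norm
    continuousOn_const hbdd
  have hmem : ((t, x) : ℝ × ℝ³) ∈ parabolicCylinder (r₀ / 2) ((T : ℝ), x) := by
    rw [mem_parabolicCylinder]
    exact ⟨ht, by simp only [dist_self]; positivity⟩
  have := hall (t, x) hmem
  simpa only [mul_div_assoc] using this

end Literature.Analysis.FluidPDE

end
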